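import Summits.CriticalPhenomena.SAWScalingLimit.Theorems.SAWInfinitesimalRigidityDefs

/-!
# Route `SAWInfinitesimalRigidity`, item `InfinitesimalRigidity` (IR0, stmt-CriticalPhenomena-5236):
the quarter-turn sign lemma for tangent vectors, and infinitesimal R* from IR0

Helper file (`--supports stmt-CriticalPhenomena-5236`). The informal item IR0 claims
`T_0(F) = sym₀(2)` for the chordal SLE(8/3) family `F` — every dilation-invariant first-order
deformation of `F` inside the exact restriction–Markov class `𝒱` is an infinitesimal linear
stretch — "consequently the quarter-turn `R` acts on `T_0` by `M ↦ R M R⁻¹ = -M` and the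
D4-invariant part of `T_0` is `0`". In the kinematic vocabulary of
`SAWInfinitesimalRigidityDefs.lean`
(`restrictionMarkovTangentSpace 0 𝒯 F = T_0(F)` along a test class `𝒯`, `stretchVelocities 𝒯 F` =
the image of `sym₀(2)`, `stretchCurve u hu F : t ↦ (L_t^{(u)})_* F`, `quarterTurn = (z ↦ i z)`,
`latticeExactClass` = `𝒱` + covariance under `z ↦ r·i^k·z + w`) this file PROVES the
"consequently" part, for every family `F` covariant under `R⁻¹` and every `R`-stable `𝒯`:

* `coord_stretchCurve_comp_quarterTurn`, `velocity_stretchCurve_comp_quarterTurn` — THE SIGN LEMMA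
  for tangent vectors: `v_u (D) (f ∘ R_*) = - v_u (R D) (f)` for the stretch velocity `v_u`
  (from `R L_t R⁻¹ = L_{-t}` and the chain rule `d/dt|₀ g(-t) = -g'(0)`);
* `eq_zero_of_isCovariantUnder_quarterTurn` — a multiple of a stretch velocity that is quarter-turn
  covariant to first order is `0`;
* `weightZero_eq_zero_of_quarterTurn` — under the IR0 inclusion `T_0(F) ⊆ stretchVelocities`, a
  quarter-turn covariant weight-0 tangent vector is `0`;
* `tangentCone_latticeExactClass_eq_zero` — under the IR0 inclusion, EVERY tangent vector at `F` of
  the lattice-exact class vanishes ("`H¹ = 0`": the first-order form at `F` of the rigidity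
  conjecture R*, stmt-CriticalPhenomena-1368, conditional on IR0), and its instances
  `tangentCone_latticeExactClass_avoidance_subset` / `…_avoidance_eq` along the avoidance observables
  (the test class of the closeness clause of `LocalRigidity`, stmt-CriticalPhenomena-4616), where
  `R`-stability is a theorem (`mem_avoidanceObservables_iff_comp_map`); `mem_latticeExactClass` —
  the families the route's items quantify over lie in the lattice-exact class.

Also the bookkeeping the proofs need (`markedDomain_map_trans_symm`, `coord_pullback_const`,
`coord_map_of_covariant`, `quarterTurn_symm_eq`). No statement of the route is restated; the IR0
inclusion appears only as a HYPOTHESIS (`hIR0`).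

## References

* V. Beffara, *Is critical 2D percolation universal?*, Progr. Probab. 60 (2008), §2.2 and Prop. 4
  [Beffara2008Universal] (linear stretches of a scaling limit; the order-4 symmetry of `ℤ²`).
* G. Lawler, O. Schramm, W. Werner, *Conformal restriction: the chordal case*, JAMS 16 (2003)
  [LawlerSchrammWerner2003Restriction] (the restriction class).
-/

noncomputable section

open Set MeasureTheory Topology Filter
open scoped NNReal ENNReal

namespace Summit.CriticalPhenomena.SAWScalingLimit.Theorems.InfinitesimalRigidity

open Literature.Probability.RandomPlanarGeometry
open Literature.Probability.RandomPlanarGeometry.ChordalFamily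

/-! ### Bookkeeping: images of marked domains, coordinates of image families, `R⁻¹` as a lattice similarity -/

/-- `ψ⁻¹ (ψ (φ D)) = φ D` for marked domains. [folklore] -/
theorem markedDomain_map_trans_symm {n : ℕ} (D : MarkedDomain n) (φ ψ : ℂ ≃ₜ ℂ) :
    (D.map (φ.trans ψ)).map ψ.symm = D.map φ := by
  rw [MarkedDomain.map_map]
  congr 1
  exact Homeomorph.ext fun z => by simp

/-- `ψ (ψ⁻¹ D) = D` for marked domains. [folklore] -/
theorem markedDomain_map_symm_map {n : ℕ} (D : MarkedDomain n) (ψ : ℂ ≃ₜ ℂ) :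
    (D.map ψ.symm).map ψ = D := by
  rw [MarkedDomain.map_map, Homeomorph.symm_trans_self, MarkedDomain.map_refl]

/-- **Coordinates of an image family** (change of variables):
`∫ f d(φ_* P)(D) = ∫ f ∘ φ_* d P(φ⁻¹ D)`. [folklore] -/
theorem coord_pullback_const {φ : ℂ ≃ₜ ℂ} (h₁ : Measurable (CurveClass.map (φ : C(ℂ, ℂ))))
    (h₂ : Measurable (CurveClass.map (φ.symm : C(ℂ, ℂ)))) (P : ChordalFamily)
    (D : DobrushinDomain) (f : CurveClass ℂ → ℝ) :
    coord (pullback P fun _ => φ.symm) D f =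
      coord P (D.map φ.symm) (f ∘ CurveClass.map ((φ : ℂ ≃ₜ ℂ) : C(ℂ, ℂ))) := by
  rw [coord, coord, pullback_const_apply]
  exact integral_map_curveClassMap h₁ h₂ _ _

/-- **Coordinates in an image domain of a covariant family**: if `P (φ D) = φ_* (P D)` for all
`D`, then `∫ g d P(φ E) = ∫ g ∘ φ_* d P(E)`. [folklore] -/
theorem coord_map_of_covariant {φ : ℂ ≃ₜ ℂ} (h₁ : Measurable (CurveClass.map (φ : C(ℂ, ℂ))))
    (h₂ : Measurable (CurveClass.map (φ.symm : C(ℂ, ℂ)))) {P : ChordalFamily}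
    (hP : ∀ D : DobrushinDomain, P (D.map φ) = (P D).map (CurveClass.map (φ : C(ℂ, ℂ))))
    (E : DobrushinDomain) (g : CurveClass ℂ → ℝ) :
    coord P (E.map φ) g = coord P E (g ∘ CurveClass.map ((φ : ℂ ≃ₜ ℂ) : C(ℂ, ℂ))) := by
  rw [coord, coord, hP E]
  exact integral_map_curveClassMap h₁ h₂ _ _

/-- The inverse quarter-turn is the LATTICE similarity `z ↦ (1 · i³) z + 0` (a multiplier
`r · i^k` with `r = 1`, `k = 3`, the shape the covariance clauses of R* / `LocalRigidity` use).
[folklore] -/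
theorem quarterTurn_symm_eq :
    quarterTurn.symm = similarity ((1 : ℝ) * Complex.I ^ 3)
      (by rw [Complex.ofReal_one, one_mul]; exact pow_ne_zero 3 Complex.I_ne_zero) 0 :=
  Homeomorph.ext fun z => by
    have h3 : Complex.I ^ 3 = -Complex.I := by rw [pow_succ, Complex.I_sq]; ring
    rw [quarterTurn, similarity_symm, similarity_apply, similarity_apply, h3,
      Complex.inv_I]
    simp


section Sign

variable {u : ℂ} {hu : ‖u‖ = 1} {F : ChordalFamily} {𝒯 : Set (CurveClass ℂ → ℝ)}

/-- **Coordinates of the stretch curve, turned.** For a family `F` covariant under the inverse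
quarter-turn, testing the `t`-stretched family on `f ∘ R_*` in `D` is testing the `(-t)`-stretched
family on `f` in `R D`: `R L_t R⁻¹ = L_{-t}` (conjugation by the rotation of `ℤ²` reverses a
traceless symmetric matrix). [cite: Beffara2008Universal, Prop. 4] -/
theorem coord_stretchCurve_comp_quarterTurn
    (hF : ∀ D : DobrushinDomain, F (D.map quarterTurn.symm) =
      (F D).map (CurveClass.map ((quarterTurn.symm : ℂ ≃ₜ ℂ) : C(ℂ, ℂ))))
    (t : ℝ) (D : DobrushinDomain) (f : CurveClass ℂ → ℝ) :
    coord (stretchCurve u hu F t) D (f ∘ CurveClass.map ((quarterTurn : ℂ ≃ₜ ℂ) : C(ℂ, ℂ))) =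
      coord (stretchCurve u hu F (-t)) (D.map quarterTurn) f := by
  have hs : ∀ s : ℝ,
      Measurable (CurveClass.map (((stretchHomeomorph u hu s).symm : ℂ ≃ₜ ℂ) : C(ℂ, ℂ))) :=
    fun s => by
      rw [stretchHomeomorph_symm]; exact measurable_curveClassMap_stretchHomeomorph u hu (-s)
  rw [stretchCurve_apply, stretchCurve_apply,
    coord_pullback_const (measurable_curveClassMap_stretchHomeomorph u hu t) (hs t),
    coord_pullback_const (measurable_curveClassMap_stretchHomeomorph u hu (-t)) (hs (-t))]
  -- move the left domain `L_t⁻¹ D = R⁻¹ (R L_t⁻¹ D)` through the covariance of `F` under `R⁻¹`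
  have hsymm : Measurable (CurveClass.map ((quarterTurn.symm.symm : ℂ ≃ₜ ℂ) : C(ℂ, ℂ))) := by
    rw [Homeomorph.symm_symm]; exact measurable_curveClassMap_quarterTurn
  rw [← markedDomain_map_trans_symm D (stretchHomeomorph u hu t).symm quarterTurn,
    coord_map_of_covariant measurable_curveClassMap_quarterTurn_symm hsymm hF]
  -- the observables agree: `R⁻¹_*` then `L_t_*` then `R_*` is `(R L_t R⁻¹)_* = (L_{-t})_*`
  have hfun : ((f ∘ CurveClass.map ((quarterTurn : ℂ ≃ₜ ℂ) : C(ℂ, ℂ))) ∘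
      CurveClass.map ((stretchHomeomorph u hu t : ℂ ≃ₜ ℂ) : C(ℂ, ℂ))) ∘
        CurveClass.map ((quarterTurn.symm : ℂ ≃ₜ ℂ) : C(ℂ, ℂ)) =
      f ∘ CurveClass.map ((stretchHomeomorph u hu (-t) : ℂ ≃ₜ ℂ) : C(ℂ, ℂ)) := by
    rw [← quarterTurn_symm_trans_stretchHomeomorph_trans_quarterTurn u hu t,
      CurveClass.map_homeomorph_trans, CurveClass.map_homeomorph_trans]
    rfl
  -- the domains agree: `R L_t⁻¹ = L_{-t}⁻¹ R`
  have hdom : (stretchHomeomorph u hu t).symm.trans quarterTurn =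
      quarterTurn.trans (stretchHomeomorph u hu (-t)).symm := by
    rw [stretchHomeomorph_symm, stretchHomeomorph_symm, neg_neg,
      stretchHomeomorph_trans_quarterTurn, neg_neg]
  rw [hfun, hdom, ← MarkedDomain.map_map]

/-- **THE SIGN LEMMA for tangent vectors.** For a family `F` covariant under the inverse
quarter-turn and a test class `𝒯` stable under the quarter-turn, the velocity `v_u` of the stretch
curve `t ↦ (L_t^{(u)})_* F` satisfies `v_u (D) (f ∘ R_*) = - v_u (R D) (f)`: the quarter-turn maps
the infinitesimal stretch `M_u` to `R M_u R⁻¹ = -M_u`. [cite: Beffara2008Universal, Prop. 4] -/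
theorem velocity_stretchCurve_comp_quarterTurn
    (hF : ∀ D : DobrushinDomain, F (D.map quarterTurn.symm) =
      (F D).map (CurveClass.map ((quarterTurn.symm : ℂ ≃ₜ ℂ) : C(ℂ, ℂ))))
    (h𝒯 : ∀ f : CurveClass ℂ → ℝ,
      f ∈ 𝒯 ↔ f ∘ CurveClass.map ((quarterTurn : ℂ ≃ₜ ℂ) : C(ℂ, ℂ)) ∈ 𝒯)
    (D : DobrushinDomain) (f : CurveClass ℂ → ℝ) :
    velocity 𝒯 (stretchCurve u hu F) D (f ∘ CurveClass.map ((quarterTurn : ℂ ≃ₜ ℂ) : C(ℂ, ℂ))) =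
      - velocity 𝒯 (stretchCurve u hu F) (D.map quarterTurn) f := by
  by_cases hf : f ∈ 𝒯
  · rw [velocity_apply_of_mem _ _ ((h𝒯 f).1 hf), velocity_apply_of_mem _ _ hf]
    simp_rw [coord_stretchCurve_comp_quarterTurn hF]
    rw [deriv_comp_neg (fun t => coord (stretchCurve u hu F t) (D.map quarterTurn) f) 0, neg_zero]
  · have hf' : f ∘ CurveClass.map ((quarterTurn : ℂ ≃ₜ ℂ) : C(ℂ, ℂ)) ∉ 𝒯 :=
      fun h => hf ((h𝒯 f).2 h)
    rw [velocity_apply_of_not_mem _ _ hf', velocity_apply_of_not_mem _ _ hf, neg_zero]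

/-- **No quarter-turn covariant stretch direction.** If a multiple `v = a • v_u` of a stretch
velocity at `F` (`F` covariant under `R⁻¹`, `𝒯` stable under `R`) is covariant to first order under
the quarter-turn (`Deformation.IsCovariantUnder 𝒯 v quarterTurn`), then `v = 0`: the only vector of
`sym₀(2)` fixed by `M ↦ R M R⁻¹ = -M` is `0` — the infinitesimal form of "the rotation of the
square lattice kills Beffara's modulus". [cite: Beffara2008Universal, Prop. 4] -/
theorem eq_zero_of_isCovariantUnder_quarterTurn
    (hF : ∀ D : DobrushinDomain, F (D.map quarterTurn.symm) =
      (F D).map (CurveClass.map ((quarterTurn.symm : ℂ ≃ₜ ℂ) : C(ℂ, ℂ))))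
    (h𝒯 : ∀ f : CurveClass ℂ → ℝ,
      f ∈ 𝒯 ↔ f ∘ CurveClass.map ((quarterTurn : ℂ ≃ₜ ℂ) : C(ℂ, ℂ)) ∈ 𝒯)
    {a : ℝ} {v : Deformation} (hv : v = a • velocity 𝒯 (stretchCurve u hu F))
    (hR : v.IsCovariantUnder 𝒯 quarterTurn) : v = 0 := by
  subst hv
  funext D f
  by_cases hf : f ∈ 𝒯
  · have key := hR (D.map quarterTurn.symm) f hf ((h𝒯 f).1 hf)
    rw [markedDomain_map_symm_map] at key
    have key2 : (a • velocity 𝒯 (stretchCurve u hu F)) (D.map quarterTurn.symm)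
        (f ∘ CurveClass.map ((quarterTurn : ℂ ≃ₜ ℂ) : C(ℂ, ℂ))) =
        - (a • velocity 𝒯 (stretchCurve u hu F)) D f := by
      simp only [Pi.smul_apply, smul_eq_mul]
      rw [velocity_stretchCurve_comp_quarterTurn hF h𝒯, markedDomain_map_symm_map]
      ring
    have h0 : (a • velocity 𝒯 (stretchCurve u hu F)) D f = 0 := by linarith [key.trans key2]
    simpa using h0
  · simp [velocity_apply_of_not_mem _ _ hf]

end Sign

section Consequence

variable {𝒯 : Set (CurveClass ℂ → ℝ)} {F : ChordalFamily}

/-- **IR0 ⇒ no quarter-turn covariant weight-0 deformation.** If every weight-0 tangent vector at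
`F` inside `𝒱` is a stretch velocity (the inclusion IR0 asserts for the SLE(8/3) family), `F` is
covariant under the inverse quarter-turn and `𝒯` is quarter-turn stable, then a weight-0 tangent
vector that is ALSO quarter-turn covariant to first order vanishes ("the D4-invariant part of `T_0`
is `0`"). [cite: Beffara2008Universal, Prop. 4] -/
theorem weightZero_eq_zero_of_quarterTurn
    (hIR0 : restrictionMarkovTangentSpace 0 𝒯 F ⊆ stretchVelocities 𝒯 F)
    (hF : ∀ D : DobrushinDomain, F (D.map quarterTurn.symm) =
      (F D).map (CurveClass.map ((quarterTurn.symm : ℂ ≃ₜ ℂ) : C(ℂ, ℂ))))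
    (h𝒯 : ∀ f : CurveClass ℂ → ℝ,
      f ∈ 𝒯 ↔ f ∘ CurveClass.map ((quarterTurn : ℂ ≃ₜ ℂ) : C(ℂ, ℂ)) ∈ 𝒯)
    {v : Deformation} (hv : v ∈ restrictionMarkovTangentSpace 0 𝒯 F)
    (hR : v.IsCovariantUnder 𝒯 quarterTurn) : v = 0 := by
  obtain ⟨a, u, hu, rfl⟩ := hIR0 hv
  exact eq_zero_of_isCovariantUnder_quarterTurn hF h𝒯 rfl hR

/-- **Infinitesimal R\* from IR0.** Under the IR0 inclusion at `F` along a quarter-turn stable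
test class `𝒯`, EVERY tangent vector at `F` of the lattice-exact class vanishes: the velocity of a
curve of lattice-similarity covariant families is dilation invariant and quarter-turn covariant to
first order (`velocity_isCovariantUnder`), lies in `T_0(F)` (the class is part of `𝒱`), hence is a
stretch velocity, hence `0` by the sign lemma (`F` itself lies in the class, so it is covariant
under `R⁻¹ = (z ↦ 1·i³·z)`). The first-order ("`H¹ = 0`") form at `F` of the rigidity conjecture
R* (stmt-CriticalPhenomena-1368), conditional on IR0. [cite: Beffara2008Universal, Prop. 4] -/
theorem tangentCone_latticeExactClass_eq_zero
    (hIR0 : restrictionMarkovTangentSpace 0 𝒯 F ⊆ stretchVelocities 𝒯 F)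
    (h𝒯 : ∀ f : CurveClass ℂ → ℝ,
      f ∈ 𝒯 ↔ f ∘ CurveClass.map ((quarterTurn : ℂ ≃ₜ ℂ) : C(ℂ, ℂ)) ∈ 𝒯)
    {v : Deformation} (hv : v ∈ tangentCone latticeExactClass F 𝒯) : v = 0 := by
  have hF : F ∈ latticeExactClass := base_mem_of_mem_tangentCone hv
  obtain ⟨c, hc, rfl⟩ := hv
  -- weight 0 (dilation invariance) and quarter-turn covariance of the velocity
  have hdil : velocity 𝒯 c ∈ weightDeformations 𝒯 0 := by
    rw [mem_weightDeformations_zero_iff]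
    intro r hr
    exact velocity_isCovariantUnder (measurable_curveClassMap_similarity _ _ _)
      (by rw [similarity_symm]; exact measurable_curveClassMap_similarity _ _ _)
      (hc.eventually_mem.mono fun ε hε D => hε.2 D _ _ _ ⟨r, 0, hr, by simp⟩)
  have hR : (velocity 𝒯 c).IsCovariantUnder 𝒯 quarterTurn :=
    velocity_isCovariantUnder measurable_curveClassMap_quarterTurn
      measurable_curveClassMap_quarterTurn_symm
      (hc.eventually_mem.mono fun ε hε D => hε.2 D _ _ _ ⟨1, 1, one_pos, by simp⟩)
  have hv0 : velocity 𝒯 c ∈ restrictionMarkovTangentSpace 0 𝒯 F :=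
    ⟨tangentCone_mono latticeExactClass_subset F 𝒯 ⟨c, hc, rfl⟩, hdil⟩
  refine weightZero_eq_zero_of_quarterTurn hIR0 (fun D => ?_) h𝒯 hv0 hR
  rw [quarterTurn_symm_eq]
  exact hF.2 D _ _ _ ⟨1, 3, one_pos, rfl⟩

/-- **Infinitesimal R\* from IR0, along the avoidance observables** (the test class of the
closeness clause of `LocalRigidity`, stmt-CriticalPhenomena-4616, for which quarter-turn stability
is a theorem): if `T_0(F) ⊆ stretchVelocities` along `avoidanceObservables` — the inclusion IR0
(stmt-CriticalPhenomena-5236) claims for the SLE(8/3) family — then the tangent cone at `F` of the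
lattice-exact class along the avoidance observables is `{0}` (it contains `0` iff `F` lies in the
class). [cite: Beffara2008Universal, Prop. 4] -/
theorem tangentCone_latticeExactClass_avoidance_subset
    (hIR0 : restrictionMarkovTangentSpace 0 avoidanceObservables F ⊆
      stretchVelocities avoidanceObservables F) :
    tangentCone latticeExactClass F avoidanceObservables ⊆ {0} :=
  fun _ hv => tangentCone_latticeExactClass_eq_zero hIR0
    (mem_avoidanceObservables_iff_comp_map quarterTurn) hv

/-- … and is exactly `{0}` when `F` itself lies in the lattice-exact class (the constant curve).
[folklore] -/
theorem tangentCone_latticeExactClass_avoidance_eq (hF : F ∈ latticeExactClass)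
    (hIR0 : restrictionMarkovTangentSpace 0 avoidanceObservables F ⊆
      stretchVelocities avoidanceObservables F) :
    tangentCone latticeExactClass F avoidanceObservables = {0} :=
  (tangentCone_latticeExactClass_avoidance_subset hIR0).antisymm
    (Set.singleton_subset_iff.2 (zero_mem_tangentCone hF))

/-- **The families of the route lie in the lattice-exact class.** A chordal family satisfying the
hypotheses of `Rigidity` (stmt-1368) / `LocalRigidity` (stmt-4616) / `GlobalFromLocal` — restriction,
a restriction-coupled Markov kernel, reversibility, covariance under `z ↦ r·i^k·z + w` — lies in
`latticeExactClass` (translations are the multipliers `1 · i⁰`; the conjugation clause of those items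
is not needed). So a curve of such families through the SLE(8/3) family `F` is a curve in
`latticeExactClass`, and under IR0 its velocity along the avoidance observables vanishes
(`tangentCone_latticeExactClass_avoidance_subset`). [folklore] -/
theorem mem_latticeExactClass {P : ChordalFamily} (h₁ : P.IsChordal) (h₂ : P.IsRestriction)
    (h₃ : ∃ Q : DobrushinDomain → CurveClass ℂ → Measure (CurveClass ℂ), P.IsMarkovExtension Q ∧
      ∀ (D : DobrushinDomain) (p : CurveClass ℂ) (D' : DobrushinDomain),
        D'.carrier ⊆ remainingDomain D p → D'.pt 0 = p.target → D'.pt 1 = D.pt 1 →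
        ∀ T : Set (CurveClass ℂ), MeasurableSet T →
          P D' T * Q D p (CurveClass.rangeSubset (closure D'.carrier)) =
            Q D p (T ∩ CurveClass.rangeSubset (closure D'.carrier)))
    (h₄ : ∀ D D' : DobrushinDomain, D'.carrier = D.carrier → D'.pt 0 = D.pt 1 → D'.pt 1 = D.pt 0 →
      P D' = (P D).map CurveClass.reverse)
    (h₅ : ∀ (D : DobrushinDomain) (c : ℂ) (hc : c ≠ 0) (w : ℂ),
      (∃ (r : ℝ) (k : ℕ), 0 < r ∧ c = (r : ℂ) * Complex.I ^ k) →
        P (D.map (similarity c hc w)) =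
          (P D).map (CurveClass.map ((similarity c hc w : ℂ ≃ₜ ℂ) : C(ℂ, ℂ))))
    (h₆ : ∀ D : DobrushinDomain, ∀ᵐ γ ∂(P D),
      γ ∈ CurveClass.simple ∧ γ.range ∩ frontier D.carrier ⊆ {D.pt 0, D.pt 1}) :
    P ∈ latticeExactClass :=
  ⟨⟨h₁, h₂, h₃, h₄, fun D w => h₅ D 1 one_ne_zero w ⟨1, 0, one_pos, by simp⟩, h₆⟩, h₅⟩

end Consequence

end Summit.CriticalPhenomena.SAWScalingLimit.Theorems.InfinitesimalRigidity
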